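import Summits.BirchSwinnertonDyer.Rank1Residual.GaloisImage.KatoKuriharaValueEmptyLevelSockets
import Summits.BirchSwinnertonDyer.Rank1Residual.GaloisImage.KolyvaginSystemOfEulerSystemPropagated
import HarnessLib

/-!
# The value socket of the PORT at EVERY tame level, for an ARBITRARY THEOREM-D output
# (ROUTE-1 §58 DESIGN NOTE D-58-1, THEOREM-D side; row T-PK6-D58; cell `b2b-bsdres`, team n1011,
# seat p11 GEN 11 — the T-DER lineage; the general-`r` twin of n1011-p13's
# `KatoKuriharaValueEmptyLevelSockets`)

HONEST FRAMING (cell `b2b-bsdres`, run/shared/lean/b2b/bsd-rank1-residual/, verbatim in every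
file): the goal of the cell is to DELETE the COMBINATION-SHAPED residual classes of the
Birch–Swinnerton-Dyer formula for ALL analytic-rank `≤ 1` elliptic curves over `ℚ` — "full BSD
formula for every rank `≤ 1` curve in class `C`" assembled STRICTLY from published theorems — so
that the rank-`≤ 1` remainder becomes exactly the CONSTRUCTION-SHAPED classes, which are TYPED
(missing-input `Prop`s), NOT attempted. This is not "finishing BSD". Team n1011: research route on
the CONSTRUCTION-SHAPED class X4 / §I N11 (route-1 PORT `T-PORT-1`, (P-DER) ∘ (P-KIM) glue).  TOOL
theorems of continuous group cohomology; NO Euler system is asserted to exist (not even as a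
hypothesis: only the SHAPE of THEOREM D's output enters); no definition, no named fact, no `sorry`;
nothing is booked; no mark / label / count moves.

## What, and why

THEOREM D of row T-DER (n1011-p11: D4 `Derivative.Rat.exists_isKolyvaginSystem_propagatedSelmerStructure`,
its `E[p^{k+1}]_{ℤ_p}` reading D6, the two-depth form D7 `…_pair_propagatedSelmerStructure`) turns an
Euler system `c` of `T_pE/ℚ` into generators `σ_ℓ`, transports `Φ_r : H¹(U_r, T′) → H¹(U_r, E[p^k·p])`
computed on cocycles by `e : T′ ≅ E[p^k·p]` (any coefficient system `red : T_pE ⟶ T′` with the PIN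
`e ∘ red = (a ↦ a_{k+1})`, D4/D7's `hcomp`), and ONE Kolyvagin system `κ` for
`𝓕_can = propagatedSelmerStructure W p k`, CHARACTERISED at every level `r ⊆ 𝒫` by
`res_{U_r} κ_r = D_r (Φ_r (red_* c_{⊥,r}))`, `D_r = ∏_{ℓ∈r} Σ_{j<ℓ−1} j σ_ℓ^j` on `H¹(U_r, E[p^k·p])`.
The (P-EXP) rider (n1011-p13's `KatoExpStarFiniteLevelAt`, PK-5) computes `Λfin (loc_v κ₀)` for a
class of the shape `res κ₀ = Ψ y` (`Ψ` computed on cocycles by `a ↦ a_{k+1}`) from a congruence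
`p^t · Λ_{0,r}(y) ≡ s ⊗ 1 (mod p^{k+1} · L_int)`.  ROUTE-1 §58 DESIGN NOTE D-58-1 (r1 GEN 46, ADOPTED
by the lead R5-109 (d)): state the general-level value law for an ARBITRARY THEOREM-D output
`(σ, Φ, comm, κ)` satisfying the displayed clause — not for a `σ` chosen inside a proof — so that
★ PK-6₂ (`KatoKuriharaPortThreeAt_of_zetaBody` over D7's two families with ONE `σ`) is one screen of
glue.  This file is the THEOREM-D side of that note:
* `comp_map_oneCocycleClass` / `comp_map_noncommProd_deriv` — `Ψ_r := Φ_r ∘ red_*` is computed on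
  cocycles by `e ∘ red` and intertwines Kolyvagin's derivative `D^T_r` on `H¹(U_r, T_pE)` (PK-1's
  spelling, `Module.End ℤ_[p]`) with `D_r` on `H¹(U_r, E[p^k·p])` (THEOREM D's, `Module.End ℤ`);
* ★ (S1) `resSubgroup_eq_comp_map_deriv` — `res_{U_r} κ_r = Ψ_r (D^T_r c_{⊥,r})`, the shape
  `res κ₀ = Ψ y` of PK-5 (ii) (`Ψ_r` admissible by n1011-p13's `KatoValue.comp_oneCocycleClass_eq_of_pin`);
* (S2) `localization_mem_of_isKolyvaginSystem` — clause (0) off the level: `loc_v κ_r ∈ 𝓕(v)`, `v ∉ r`;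
* ★★ (S3) `apply_localization_eq_toZModPow_of_res_eq_deriv` (one level, any coefficient system, any
  generators) and ★★★ `apply_localization_eq_toZModPow_of_derivativeFamily` (THEOREM D's LITERAL
  currency: the `∀ r ⊆ 𝒫` family of D4/D6/D7, the Euler system's classes `c`, `v ∣ p`):
  **`Λfin (loc_v κ_r) = s mod p^{k+1}`** whenever `p^t · Λ_{0,r}(D^T_r c_{⊥,r}) − s ⊗ 1 ∈ p^{k+1} · L_int`.

CONSUMERS BY NAME (not here): PK-6 general = (S3) [or (S1)+(S2)+T-PK-PAR's parity projection,
n1011-p13 lineage] + PK-4b's value witness `s` (n1011-p15 lineage); ★ PK-6₂ = (S3) at depths `k ≤ m`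
on D7's paired output + D7's (COMP).  NOT here: any value witness, its identification with
`u · p^t · δ̃_n`, the parity projection, END-b, any `_holds`.  General `p`, `k`, `t`, `S`.
References: K. Rubin, *Euler Systems* (2000), Def. 4.4.1, Def. 4.4.4, Lemma 4.4.2 [Rubin2000];
B. Mazur, K. Rubin, Mem. AMS 799 (2004), Thm. 3.2.4, App. A [MazurRubin2004]; C.-H. Kim, AJM 148
(2026) = arXiv:2203.12159, §3.4.1, proof of Thm. 3.13 (arXiv v3 pp. 26–27) [Kim2022StructureSelmer];
R. Sakamoto, JTNB 36 (2024), Def. 3.3, Def. 4.1 [Sakamoto2024]; design of record `cells/n1011/ROUTE-1.md`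
§53.4 (PK-5), §58 (D-58-1); `cells/n1011/skel/T-PORT-1-PKIM.md` v0.4 (11).
-/

noncomputable section

open scoped NumberField TensorProduct
open CategoryTheory Field Finset IsDedekindDomain NumberField WeierstrassCurve Rat.HeightOneSpectrum
open Literature.NumberTheory.GaloisRepresentations Literature.NumberTheory.GaloisCohomology
open Literature.NumberTheory.GaloisRepresentations.DiscreteGaloisModule
open Literature.NumberTheory.EllipticCurves Literature.NumberTheory.EllipticCurves.Kato2004
open Literature.NumberTheory.EllipticCurves.Kato2004.EulerSystemValues

namespace Summit.BirchSwinnertonDyer.Rank1Residual.GaloisImage.KatoValue.GeneralLevel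

/-! ## §1 The composite transport `Ψ = Φ ∘ red_*` and Kolyvagin's derivative -/
section Generic

variable {W : WeierstrassCurve ℚ} [W.IsElliptic] {p : ℕ} [Fact p.Prime]
  [ContinuousSMul ℤ_[p] (W.tateModule p)] {M : ℤ}
  {M' : Type} [AddCommGroup M'] [Module ℤ_[p] M'] [TopologicalSpace M'] [IsTopologicalAddGroup M']
  [ContinuousSMul ℤ_[p] M'] {T' : GaloisRep ℚ ℤ_[p] M'}

/-- Local notation: `𝐫⟦red, U⟧ = red_* : H¹(U, T_pE) → H¹(U, T′)` on the level `U`. -/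
local notation3 (prettyPrint := false) "𝐫⟦" red ", " U "⟧" =>
  ContinuousCohomology.map (ContinuousMonoidHom.id U)
    (X := subgroupRep (tateRep W p).toTopRep U) (Y := subgroupRep (ContinuousRep.toTopRep T') U)
    ((TopRep.resFunctor (Subgroup.subtype U)).map red) 1

/-- **`Ψ = Φ ∘ red_*` is computed on cocycles by `e ∘ red`**: for a coefficient map
`red : T_pE ⟶ T′`, a transport `Φ : H¹(U, T′) → H¹(U, E[M])` computed on cocycles by `e : T′ → E[M]`
(THEOREM D's `Φ_r`), and cocycles `φ` of `T_pE|_U`, `ψ` of `E[M]|_U` with `ψ = e ∘ red ∘ φ`: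
`Φ (red_* [φ]) = [ψ]` (`Derivative.CoeffChange.map_id_oneCocycleClass`). [folklore] -/
theorem comp_map_oneCocycleClass (red : (tateRep W p).toTopRep ⟶ T'.toTopRep)
    (e : M' →+ geomTorsion W M) (U : Subgroup (absoluteGaloisGroup ℚ))
    (Φ : continuousCohomology 1 (subgroupRep T'.toTopRep U) →+
      continuousCohomology 1 (subgroupRep (W.torsionGaloisModule M).toTopRep U))
    (hΦ : ∀ (φ : contOneCocycles (subgroupRep T'.toTopRep U))
      (ψ : contOneCocycles (subgroupRep (W.torsionGaloisModule M).toTopRep U)),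
      (∀ g, ψ.1 g = e (φ.1 g)) → Φ (oneCocycleClass _ φ) = oneCocycleClass _ ψ)
    (φ : contOneCocycles (subgroupRep (tateRep W p).toTopRep U))
    (ψ : contOneCocycles (subgroupRep (W.torsionGaloisModule M).toTopRep U))
    (hφψ : ∀ g, ψ.1 g = e (red.hom (φ.1 g))) :
    Φ (𝐫⟦red, U⟧ (oneCocycleClass _ φ)) = oneCocycleClass _ ψ := by
  set π := (TopRep.resFunctor U.subtype).map red with hπ
  let φ' : contOneCocycles (subgroupRep T'.toTopRep U) :=
    ⟨_, CoeffTransport.comp_mem_contOneCocycles (subgroupRep (tateRep W p).toTopRep U)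
      (subgroupRep T'.toTopRep U) (π.hom : _ →+ _) π.hom.continuous
      (fun g x => TopRep.hom_comm_apply π g x) φ⟩
  rw [Derivative.CoeffChange.map_id_oneCocycleClass π φ φ' (fun _ => rfl)]
  exact hΦ φ' ψ hφψ

/-- **`Ψ = Φ ∘ red_*` intertwines Kolyvagin's derivative operators**: for a normal level `U`,
generators `σ_i ∈ Γ_ℚ`, lengths `N_i`, `e` continuous and equivariant: `Φ (red_* (D^T y)) = D (Φ (red_* y))`,
`D^T = ∏_{i∈s} Σ_{j<N_i} j σ_i^j` on `H¹(U, T_pE)` (`ℤ_p`-spelling, PK-1) and `D` the same operator on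
`H¹(U, E[M])` (`ℤ`-spelling, THEOREM D) — `CoeffTransport.comm_noncommProd_deriv_conjMap` for the
transport `Φ ∘ red_*` computed on cocycles by `e ∘ red`. [cite: Rubin2000, Def. 4.4.1] -/
theorem comp_map_noncommProd_deriv (red : (tateRep W p).toTopRep ⟶ T'.toTopRep)
    (e : M' →+ geomTorsion W M) (hec : Continuous e)
    (he : ∀ (g : absoluteGaloisGroup ℚ) (x : M'),
      e (T'.toTopRep.ρ g x) = (W.torsionGaloisModule M).toTopRep.ρ g (e x))
    (U : Subgroup (absoluteGaloisGroup ℚ)) [U.Normal]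
    (Φ : continuousCohomology 1 (subgroupRep T'.toTopRep U) →+
      continuousCohomology 1 (subgroupRep (W.torsionGaloisModule M).toTopRep U))
    (hΦ : ∀ (φ : contOneCocycles (subgroupRep T'.toTopRep U))
      (ψ : contOneCocycles (subgroupRep (W.torsionGaloisModule M).toTopRep U)),
      (∀ g, ψ.1 g = e (φ.1 g)) → Φ (oneCocycleClass _ φ) = oneCocycleClass _ ψ)
    {ι : Type*} (σ : ι → absoluteGaloisGroup ℚ) (N : ι → ℕ) (s : Finset ι) (commT) (comm)
    (y : H1 (tateRep W p) U) :
    Φ (𝐫⟦red, U⟧ (s.noncommProd (fun i => ∑ j ∈ Finset.range (N i),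
        (j : Module.End ℤ_[p] (H1 (tateRep W p) U)) *
          (conjMap (tateRep W p).toTopRep U (σ i) 1).hom.toLinearMap ^ j) commT y)) =
      s.noncommProd (fun i => ∑ j ∈ Finset.range (N i),
        (j : Module.End ℤ (continuousCohomology 1 (subgroupRep (W.torsionGaloisModule M).toTopRep U))) *
          (conjMap (W.torsionGaloisModule M).toTopRep U (σ i) 1).hom.toLinearMap ^ j) comm
        (Φ (𝐫⟦red, U⟧ y)) := by
  let Ψ : H1 (tateRep W p) U →+
      continuousCohomology 1 (subgroupRep (W.torsionGaloisModule M).toTopRep U) :=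
    Φ.comp (𝐫⟦red, U⟧).hom.toLinearMap.toAddMonoidHom
  have hΨ : ∀ (φ : contOneCocycles (subgroupRep (tateRep W p).toTopRep U))
      (ψ : contOneCocycles (subgroupRep (W.torsionGaloisModule M).toTopRep U)),
      (∀ g, ψ.1 g = (e.comp (red.hom : W.tateModule p →+ M')) (φ.1 g)) →
        Ψ (oneCocycleClass _ φ) = oneCocycleClass _ ψ :=
    fun φ ψ h => comp_map_oneCocycleClass red e U Φ hΦ φ ψ h
  exact CoeffTransport.comm_noncommProd_deriv_conjMap (tateRep W p).toTopRep
    (W.torsionGaloisModule M).toTopRep (e.comp (red.hom : W.tateModule p →+ M')) U σ N s Ψ hΨ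
    (hec.comp red.hom.continuous) (fun g x => by
      rw [AddMonoidHom.comp_apply, AddMonoidHom.comp_apply, AddMonoidHom.coe_coe,
        TopRep.hom_comm_apply red g x, he]) commT comm y

/-- **★ (S1) THEOREM D's characterisation clause with the derivative INSIDE the coefficient change**:
if `κ₀ ∈ H¹(ℚ, E[M])` satisfies THEOREM D's displayed clause `res_U κ₀ = D (Φ (red_* y))`
(`y ∈ H¹(U, T_pE)` the Euler system's class of the level), then `res_U κ₀ = Ψ (D^T y)`,
`Ψ = Φ ∘ red_*` — the shape `res κ₀ = Ψ y′` consumed by the (P-EXP) rider `KatoExpStarFiniteLevelAt`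
(ii) (Rubin Def. 4.4.4 under a change of coefficients). [cite: Rubin2000, Def. 4.4.4 and Lemma 4.4.2] -/
theorem resSubgroup_eq_comp_map_deriv (red : (tateRep W p).toTopRep ⟶ T'.toTopRep)
    (e : M' →+ geomTorsion W M) (hec : Continuous e)
    (he : ∀ (g : absoluteGaloisGroup ℚ) (x : M'),
      e (T'.toTopRep.ρ g x) = (W.torsionGaloisModule M).toTopRep.ρ g (e x))
    (U : Subgroup (absoluteGaloisGroup ℚ)) [U.Normal]
    (Φ : continuousCohomology 1 (subgroupRep T'.toTopRep U) →+
      continuousCohomology 1 (subgroupRep (W.torsionGaloisModule M).toTopRep U))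
    (hΦ : ∀ (φ : contOneCocycles (subgroupRep T'.toTopRep U))
      (ψ : contOneCocycles (subgroupRep (W.torsionGaloisModule M).toTopRep U)),
      (∀ g, ψ.1 g = e (φ.1 g)) → Φ (oneCocycleClass _ φ) = oneCocycleClass _ ψ)
    {ι : Type*} (σ : ι → absoluteGaloisGroup ℚ) (N : ι → ℕ) (s : Finset ι) (commT) (comm)
    (y : H1 (tateRep W p) U) (κ₀ : galoisCohomology (W.torsionGaloisModule M) 1)
    (hres : resSubgroup (W.torsionGaloisModule M).toTopRep U 1 κ₀ =
      s.noncommProd (fun i => ∑ j ∈ Finset.range (N i),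
        (j : Module.End ℤ (continuousCohomology 1 (subgroupRep (W.torsionGaloisModule M).toTopRep U))) *
          (conjMap (W.torsionGaloisModule M).toTopRep U (σ i) 1).hom.toLinearMap ^ j) comm
        (Φ (𝐫⟦red, U⟧ y))) :
    resSubgroup (W.torsionGaloisModule M).toTopRep U 1 κ₀ =
      Φ (𝐫⟦red, U⟧ (s.noncommProd (fun i => ∑ j ∈ Finset.range (N i),
        (j : Module.End ℤ_[p] (H1 (tateRep W p) U)) *
          (conjMap (tateRep W p).toTopRep U (σ i) 1).hom.toLinearMap ^ j) commT y)) := by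
  rw [hres, comp_map_noncommProd_deriv red e hec he U Φ hΦ σ N s commT comm y]

end Generic

/-! ## §2 Clause (0) off the level, from the Kolyvagin-system property -/
section Selmer

variable {W : WeierstrassCurve ℚ} [W.IsElliptic] {M : ℤ}

omit [W.IsElliptic] in
/-- **(S2) A Kolyvagin system's class of level `r` satisfies the UNMODIFIED local condition off
`r`**: `κ_r ∈ H¹_{𝓕(r)}(ℚ, E[M])` and `𝓕(r)_v = 𝓕_v` for `v ∉ r`.  For THEOREM D's `κ` and `𝓕_can`
this is clause (0) of DICT3 at `v ∣ p` — the `hloc` input of `KatoExpStarFiniteLevelAt` (ii).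
[cite: Sakamoto2024, Def. 3.3 (p. 922) and Def. 4.1 (p. 926)] [cite: MazurRubin2004, Def. 3.1.3] -/
theorem localization_mem_of_isKolyvaginSystem
    {D : KolyvaginDatum (W.torsionGaloisModule M)} {𝓕 : SelmerStructure (W.torsionGaloisModule M)}
    {κ : Finset (HeightOneSpectrum (𝓞 ℚ)) → galoisCohomology (W.torsionGaloisModule M) 1}
    (hKS : D.IsKolyvaginSystem 𝓕 κ) {r : Finset (HeightOneSpectrum (𝓞 ℚ))} (hr : D.IsLevel r)
    {v : HeightOneSpectrum (𝓞 ℚ)} (hv : v ∉ r) :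
    galoisCohomology.localization (W.torsionGaloisModule M) (Sum.inr v) 1 (κ r) ∈ 𝓕 (Sum.inr v) := by
  have h : galoisCohomology.localization (W.torsionGaloisModule M) (Sum.inr v) 1 (κ r) ∈
      𝓕.modify D.transverse ∅ ∅ r (Sum.inr v) :=
    (SelmerStructure.mem_selmerGroup_iff _ _).1 (hKS.mem_selmerGroup r hr) (Sum.inr v)
  rwa [SelmerStructure.modify_inr_of_not_mem _ _ (Finset.notMem_empty v) (Finset.notMem_empty v) hv]
    at h

end Selmer

/-! ## §3 ★★ The value socket at one level (any coefficient system, any generators) -/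
section Socket

variable {W : WeierstrassCurve ℚ} [W.IsElliptic] {p : ℕ} [Fact p.Prime]
  [ContinuousSMul ℤ_[p] (W.tateModule p)]
  {M' : Type} [AddCommGroup M'] [Module ℤ_[p] M'] [TopologicalSpace M'] [IsTopologicalAddGroup M']
  [ContinuousSMul ℤ_[p] M'] {T' : GaloisRep ℚ ℤ_[p] M'}
  {k t : ℕ} {v : HeightOneSpectrum (𝓞 ℚ)}
  {Λ : ∀ (k' : ℕ) (r : Finset (HeightOneSpectrum (𝓞 ℚ))),
    H1 (tateRep W p) (cycSubgroup p k' r) →ₗ[ℤ_[p]] ℚ_[p] ⊗[ℚ] CyclotomicField (cycLevel p k' r) ℚ}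
  {Λfin : galoisCohomology ((W.torsionGaloisModule ((p : ℤ) ^ k * (p : ℤ))).toLocal
    (Sum.inr v)) 1 →+ ZMod (p ^ (k + 1))}

/-- Local notation: `𝐫⟦red, U⟧ = red_* : H¹(U, T_pE) → H¹(U, T′)`. -/
local notation3 (prettyPrint := false) "𝐫⟦" red ", " U "⟧" =>
  ContinuousCohomology.map (ContinuousMonoidHom.id U)
    (X := subgroupRep (tateRep W p).toTopRep U) (Y := subgroupRep (ContinuousRep.toTopRep T') U)
    ((TopRep.resFunctor (Subgroup.subtype U)).map red) 1

/-- **★★ (S3) THE VALUE SOCKET OF THE PORT AT ONE TAME LEVEL, FOR AN ARBITRARY THEOREM-D OUTPUT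
(ROUTE-1 §58 D-58-1).**  Data: the rider `hfin`; a coefficient system `red : T_pE ⟶ T′`,
`e : T′ → E[p^k·p]` continuous, equivariant, PINNED (`e ∘ red = (a ↦ a_{k+1})`); at the tame level
`r`: a transport `Φ` computed on cocycles by `e`, generators `σ_i`, lengths `N_i`, a class
`y ∈ H¹(U_r, T_pE)` (the Euler system's `c_{⊥,r}`), a class `κ₀ ∈ H¹(ℚ, E[p^k·p])` with THEOREM D's
clause `res κ₀ = D (Φ (red_* y))` and clause (0) `loc_v κ₀ ∈ 𝓕_can(v)`, and `s ∈ ℤ_p` with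
`p^t · Λ_{0,r}(D^T y) − s ⊗ 1 ∈ p^{k+1} · L_int`.  THEN `Λfin (loc_v κ₀) = s mod p^{k+1}` — PK-5 (ii)
`KatoExpStarFiniteLevelAt.apply_localization_eq_toZModPow` for the admissible `Ψ = Φ ∘ red_*`
(n1011-p13's pin glue `KatoValue.comp_oneCocycleClass_eq_of_pin`) and (S1).
[cite: Kim2022StructureSelmer, §3.4.1 and the proof of Thm. 3.13 (arXiv v3 pp. 26–27; = Thm. 3.11 of AJM 148)]
[cite: Rubin2000, Def. 4.4.4] -/
theorem apply_localization_eq_toZModPow_of_res_eq_deriv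
    (hfin : KatoExpStarFiniteLevelAt W p k t v Λ Λfin)
    (red : (tateRep W p).toTopRep ⟶ T'.toTopRep)
    (e : M' →+ geomTorsion W ((p : ℤ) ^ k * (p : ℤ))) (hec : Continuous e)
    (he : ∀ (g : absoluteGaloisGroup ℚ) (x : M'),
      e (T'.toTopRep.ρ g x) = (W.torsionGaloisModule ((p : ℤ) ^ k * (p : ℤ))).toTopRep.ρ g (e x))
    (hpin : ∀ a : W.tateModule p,
      ((e (red.hom a) : geomTorsion W ((p : ℤ) ^ k * (p : ℤ))) : geomPoints W) =
        TateModule.proj p (k + 1) a)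
    (r : Finset (HeightOneSpectrum (𝓞 ℚ)))
    (Φ : continuousCohomology 1 (subgroupRep T'.toTopRep (cycSubgroup p 0 r)) →+
      continuousCohomology 1
        (subgroupRep (W.torsionGaloisModule ((p : ℤ) ^ k * (p : ℤ))).toTopRep (cycSubgroup p 0 r)))
    (hΦ : ∀ (φ : contOneCocycles (subgroupRep T'.toTopRep (cycSubgroup p 0 r)))
      (ψ : contOneCocycles
        (subgroupRep (W.torsionGaloisModule ((p : ℤ) ^ k * (p : ℤ))).toTopRep (cycSubgroup p 0 r))),
      (∀ g, ψ.1 g = e (φ.1 g)) → Φ (oneCocycleClass _ φ) = oneCocycleClass _ ψ)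
    {ι : Type*} (σ : ι → absoluteGaloisGroup ℚ) (N : ι → ℕ) (s : Finset ι) (commT) (comm)
    (y : H1 (tateRep W p) (cycSubgroup p 0 r))
    (κ₀ : galoisCohomology (W.torsionGaloisModule ((p : ℤ) ^ k * (p : ℤ))) 1)
    (hres : resSubgroup (W.torsionGaloisModule ((p : ℤ) ^ k * (p : ℤ))).toTopRep (cycSubgroup p 0 r)
        1 κ₀ =
      s.noncommProd (fun i => ∑ j ∈ Finset.range (N i),
        (j : Module.End ℤ (continuousCohomology 1 (subgroupRep
          (W.torsionGaloisModule ((p : ℤ) ^ k * (p : ℤ))).toTopRep (cycSubgroup p 0 r)))) *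
          (conjMap (W.torsionGaloisModule ((p : ℤ) ^ k * (p : ℤ))).toTopRep (cycSubgroup p 0 r)
            (σ i) 1).hom.toLinearMap ^ j) comm
        (Φ (𝐫⟦red, cycSubgroup p 0 r⟧ y)))
    (hloc : galoisCohomology.localization (W.torsionGaloisModule ((p : ℤ) ^ k * (p : ℤ)))
      (Sum.inr v) 1 κ₀ ∈ propagatedSelmerStructure W p k (Sum.inr v))
    (sc : ℤ_[p])
    (hval : ∃ l ∈ cycIntLattice p (cycLevel p 0 r),
      ((p : ℤ_[p]) ^ t) • Λ 0 r (s.noncommProd (fun i => ∑ j ∈ Finset.range (N i),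
          (j : Module.End ℤ_[p] (H1 (tateRep W p) (cycSubgroup p 0 r))) *
            (conjMap (tateRep W p).toTopRep (cycSubgroup p 0 r) (σ i) 1).hom.toLinearMap ^ j)
          commT y) -
        ((sc : ℚ_[p]) ⊗ₜ[ℚ] (1 : CyclotomicField (cycLevel p 0 r) ℚ)) =
        ((p : ℤ_[p]) ^ (k + 1)) • (l : ℚ_[p] ⊗[ℚ] CyclotomicField (cycLevel p 0 r) ℚ)) :
    Λfin (galoisCohomology.localization (W.torsionGaloisModule ((p : ℤ) ^ k * (p : ℤ)))
        (Sum.inr v) 1 κ₀) = PadicInt.toZModPow (k + 1) sc := by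
  -- `Ψ := Φ ∘ red_*` is admissible (pin glue) and `res κ₀ = Ψ (D^T y)` by (S1)
  let Ψ : H1 (tateRep W p) (cycSubgroup p 0 r) →+
      continuousCohomology 1
        (subgroupRep (W.torsionGaloisModule ((p : ℤ) ^ k * (p : ℤ))).toTopRep (cycSubgroup p 0 r)) :=
    Φ.comp (𝐫⟦red, cycSubgroup p 0 r⟧).hom.toLinearMap.toAddMonoidHom
  exact hfin.apply_localization_eq_toZModPow r Ψ
    (fun φ ψ h => comp_oneCocycleClass_eq_of_pin red e hpin (cycSubgroup p 0 r) Φ hΦ φ ψ h) _ κ₀ sc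
    (resSubgroup_eq_comp_map_deriv red e hec he (cycSubgroup p 0 r) Φ hΦ σ N s commT comm y κ₀ hres)
    hloc hval

end Socket

/-! ## §4 ★★★ The value socket in THEOREM D's literal currency (D4 / D6 / D7 output, every level) -/
section Family

variable (W : WeierstrassCurve ℚ) [W.IsElliptic] (p : ℕ) [Fact p.Prime]
  [ContinuousSMul ℤ_[p] (W.tateModule p)]

/-- **The `T_pE`-side derivative operators of a level pairwise commute** (PK-1's spelling on
`H¹(ℚ(μ_r), T_pE)`; `Γ_ℚ / U_r` is abelian) — the `commT` input of the sockets, for consumers who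
want it by name (`Derivative.pairwise_commute_deriv`). [cite: Rubin2000, Def. 4.4.1] -/
theorem pairwise_commute_tateDeriv (r : Finset (HeightOneSpectrum (𝓞 ℚ)))
    {ι : Type*} (σ : ι → absoluteGaloisGroup ℚ) (N : ι → ℕ) (s : Finset ι) :
    (s : Set ι).Pairwise fun a b => Commute
      (∑ j ∈ Finset.range (N a), (j : Module.End ℤ_[p] (H1 (tateRep W p) (cycSubgroup p 0 r))) *
        (conjMap (tateRep W p).toTopRep (cycSubgroup p 0 r) (σ a) 1).hom.toLinearMap ^ j)
      (∑ j ∈ Finset.range (N b), (j : Module.End ℤ_[p] (H1 (tateRep W p) (cycSubgroup p 0 r))) *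
        (conjMap (tateRep W p).toTopRep (cycSubgroup p 0 r) (σ b) 1).hom.toLinearMap ^ j) :=
  fun a _ b _ _ => Derivative.commute_deriv_deriv
    (fun a b => Derivative.commute_conjMap_hom_level
      (L := cyclotomicLevelsRat p (∅ : Set (HeightOneSpectrum (𝓞 ℚ)))) (T' := tateRep W p) 0 r
      (σ a) (σ b)) N a b

variable (S : Set (HeightOneSpectrum (𝓞 ℚ)))

/-- Local notation: `𝓛` = the cyclotomic Euler-system levels with bad places `S`. -/
local notation3 "𝓛" => cyclotomicLevelsRat p S

/-- Local notation: `𝐃⟦X, U, τ⟧ ℓ = ∑_{j < ℓ−1} j·(τ_ℓ)_*^j` on `H¹(U, X)` (THEOREM D's spelling). -/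
local notation3 (prettyPrint := false) "𝐃⟦" X ", " U ", " τ "⟧" =>
  fun ℓ : HeightOneSpectrum (𝓞 ℚ) =>
  ∑ j ∈ Finset.range (((primesEquiv ℓ : Nat.Primes) : ℕ) - 1),
    (j : Module.End ℤ (continuousCohomology 1 (subgroupRep X U))) *
      (conjMap X U ((τ : HeightOneSpectrum (𝓞 ℚ) → absoluteGaloisGroup ℚ) ℓ) 1).hom.toLinearMap ^ j

/-- Local notation: `𝐃T⟦r, τ⟧ ℓ = ∑_{j < ℓ−1} j·(τ_ℓ)_*^j` on `H¹(ℚ(μ_r), T_pE)` (PK-1's spelling). -/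
local notation3 (prettyPrint := false) "𝐃T⟦" r ", " τ "⟧" =>
  fun ℓ : HeightOneSpectrum (𝓞 ℚ) =>
  ∑ j ∈ Finset.range (((primesEquiv ℓ : Nat.Primes) : ℕ) - 1),
    (j : Module.End ℤ_[p] (H1 (tateRep W p) (cycSubgroup p 0 r))) *
      (conjMap (tateRep W p).toTopRep (cycSubgroup p 0 r)
        ((τ : HeightOneSpectrum (𝓞 ℚ) → absoluteGaloisGroup ℚ) ℓ) 1).hom.toLinearMap ^ j

/-- **★★★ (S3, family form) THE GENERAL-LEVEL VALUE SOCKET FOR AN ARBITRARY THEOREM-D OUTPUT, IN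
THEOREM D's LITERAL CURRENCY (ROUTE-1 §58 D-58-1).**  Data: the rider `hfin` at `v ∣ p`; the Euler
system's classes `c_{i,r}` on the levels of `𝓛 = cyclotomicLevelsRat p S` (NO Euler-system axiom is
used); a coefficient system `(T′, red, e)`, `e` continuous, equivariant, pinned (D4/D7's `hcomp`,
D6's `rfl`); a datum `D` with `𝒫 ⊆ 𝓛.primes`; THEOREM D's output EXACTLY as displayed by
`Derivative.Rat.exists_isKolyvaginSystem_propagatedSelmerStructure` (D4) / `…_torsionCoeff` (D6) /
`…_pair_…` (D7): `σ`, `Φ` (`hΦ`), `comm`, ONE family `κ` with `hKS` and the characterisation clause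
`hres`.  THEN for every level `r ⊆ 𝒫` and every `s ∈ ℤ_p` with
`p^t · Λ_{0,r}(D^T_r c_{⊥,r}) − s ⊗ 1 ∈ p^{k+1} · L_int` (`D^T_r` for the SAME `σ` on `H¹(ℚ(μ_r), T_pE)`,
PK-1's spelling; any `commT`, e.g. `pairwise_commute_tateDeriv`): **`Λfin (loc_v κ_r) = s mod p^{k+1}`**.
PK-6 general = this + PK-4b's `s`; ★ PK-6₂ = two calls on D7's paired output (same `σ`) + (COMP).
[cite: Kim2022StructureSelmer, §3.4.1 and the proof of Thm. 3.13 (arXiv v3 pp. 26–27; = Thm. 3.11 of AJM 148)]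
[cite: MazurRubin2004, Thm. 3.2.4 and App. A] [cite: Rubin2000, Def. 4.4.4] -/
theorem apply_localization_eq_toZModPow_of_derivativeFamily
    {k t : ℕ} {v : HeightOneSpectrum (𝓞 ℚ)}
    {Λ : ∀ (k' : ℕ) (r : Finset (HeightOneSpectrum (𝓞 ℚ))),
      H1 (tateRep W p) (cycSubgroup p k' r) →ₗ[ℤ_[p]] ℚ_[p] ⊗[ℚ] CyclotomicField (cycLevel p k' r) ℚ}
    {Λfin : galoisCohomology ((W.torsionGaloisModule ((p : ℤ) ^ k * (p : ℤ))).toLocal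
      (Sum.inr v)) 1 →+ ZMod (p ^ (k + 1))}
    (hfin : KatoExpStarFiniteLevelAt W p k t v Λ Λfin)
    (c : ∀ (i : ℕ) (r : (𝓛).Ideals), H1 (tateRep W p) ((𝓛).level i r.1))
    {M' : Type} [AddCommGroup M'] [Module ℤ_[p] M'] [TopologicalSpace M'] [IsTopologicalAddGroup M']
    [ContinuousSMul ℤ_[p] M'] {T' : GaloisRep ℚ ℤ_[p] M'}
    (red : (tateRep W p).toTopRep ⟶ T'.toTopRep)
    (e : M' →+ geomTorsion W ((p : ℤ) ^ k * (p : ℤ))) (hec : Continuous e)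
    (he : ∀ (g : absoluteGaloisGroup ℚ) (x : M'),
      e (T'.toTopRep.ρ g x) = (W.torsionGaloisModule ((p : ℤ) ^ k * (p : ℤ))).toTopRep.ρ g (e x))
    (hpin : ∀ a : W.tateModule p,
      ((e (red.hom a) : geomTorsion W ((p : ℤ) ^ k * (p : ℤ))) : geomPoints W) =
        TateModule.proj p (k + 1) a)
    (D : KolyvaginDatum (W.torsionGaloisModule ((p : ℤ) ^ k * (p : ℤ))))
    (hPr : D.primes ⊆ (𝓛).primes)
    (σ : HeightOneSpectrum (𝓞 ℚ) → absoluteGaloisGroup ℚ)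
    (Φ : ∀ r : Finset (HeightOneSpectrum (𝓞 ℚ)),
      continuousCohomology 1 (subgroupRep T'.toTopRep ((𝓛).level ⊥ r)) →+
        continuousCohomology 1 (subgroupRep
          (W.torsionGaloisModule ((p : ℤ) ^ k * (p : ℤ))).toTopRep ((𝓛).level ⊥ r)))
    (comm : ∀ r : Finset (HeightOneSpectrum (𝓞 ℚ)),
      ((r : Finset _) : Set (HeightOneSpectrum (𝓞 ℚ))).Pairwise fun a b =>
        Commute (𝐃⟦(W.torsionGaloisModule ((p : ℤ) ^ k * (p : ℤ))).toTopRep, ((𝓛).level ⊥ r), σ⟧ a)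
          (𝐃⟦(W.torsionGaloisModule ((p : ℤ) ^ k * (p : ℤ))).toTopRep, ((𝓛).level ⊥ r), σ⟧ b))
    (κ : Finset (HeightOneSpectrum (𝓞 ℚ)) →
      galoisCohomology (W.torsionGaloisModule ((p : ℤ) ^ k * (p : ℤ))) 1)
    (hΦ : ∀ r, ∀ (φ : contOneCocycles (subgroupRep T'.toTopRep ((𝓛).level ⊥ r)))
      (ψ : contOneCocycles (subgroupRep
        (W.torsionGaloisModule ((p : ℤ) ^ k * (p : ℤ))).toTopRep ((𝓛).level ⊥ r))),
      (∀ g, ψ.1 g = e (φ.1 g)) → Φ r (oneCocycleClass _ φ) = oneCocycleClass _ ψ)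
    (hKS : D.IsKolyvaginSystem (propagatedSelmerStructure W p k) κ)
    (hres : ∀ (r : Finset (HeightOneSpectrum (𝓞 ℚ))) (hr : (↑r : Set _) ⊆ D.primes),
      resSubgroup (W.torsionGaloisModule ((p : ℤ) ^ k * (p : ℤ))).toTopRep ((𝓛).level ⊥ r) 1 (κ r) =
        (r.noncommProd 𝐃⟦(W.torsionGaloisModule ((p : ℤ) ^ k * (p : ℤ))).toTopRep,
            ((𝓛).level ⊥ r), σ⟧ (comm r))
          (Φ r (ContinuousCohomology.map (ContinuousMonoidHom.id _)
            (X := subgroupRep (tateRep W p).toTopRep ((𝓛).level ⊥ r))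
            (Y := subgroupRep T'.toTopRep ((𝓛).level ⊥ r))
            ((TopRep.resFunctor ((𝓛).level ⊥ r).subtype).map red) 1
            (c ⊥ ⟨r, fun _ hq => hPr (hr (Finset.mem_coe.2 hq))⟩))))
    (hvp : ((primesEquiv v : Nat.Primes) : ℕ) = p)
    (r : Finset (HeightOneSpectrum (𝓞 ℚ))) (hr : (↑r : Set _) ⊆ D.primes) (commT) (sc : ℤ_[p])
    (hval : ∃ l ∈ cycIntLattice p (cycLevel p 0 r),
      ((p : ℤ_[p]) ^ t) • Λ 0 r ((r.noncommProd 𝐃T⟦r, σ⟧ commT)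
          (c ⊥ ⟨r, fun _ hq => hPr (hr (Finset.mem_coe.2 hq))⟩)) -
        ((sc : ℚ_[p]) ⊗ₜ[ℚ] (1 : CyclotomicField (cycLevel p 0 r) ℚ)) =
        ((p : ℤ_[p]) ^ (k + 1)) • (l : ℚ_[p] ⊗[ℚ] CyclotomicField (cycLevel p 0 r) ℚ)) :
    Λfin (galoisCohomology.localization (W.torsionGaloisModule ((p : ℤ) ^ k * (p : ℤ)))
        (Sum.inr v) 1 (κ r)) = PadicInt.toZModPow (k + 1) sc := by
  have hvr : v ∉ r := fun hmem => (hPr (hr (Finset.mem_coe.2 hmem))).2 hvp  -- usable primes `≠ p`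
  exact apply_localization_eq_toZModPow_of_res_eq_deriv hfin red e hec he hpin r (Φ r) (hΦ r) σ
    (fun ℓ => ((primesEquiv ℓ : Nat.Primes) : ℕ) - 1) r commT (comm r) _ (κ r) (hres r hr)
    (localization_mem_of_isKolyvaginSystem hKS hr hvr) sc hval
end Family

end Summit.BirchSwinnertonDyer.Rank1Residual.GaloisImage.KatoValue.GeneralLevel

end
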